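import Mathlib
import Summits.ResolutionOfSingularities.ResolutionOfSingularities.Theorems.RadicialJungCleanModelsCleanProp44CurveSliceMinCut
import Summits.ResolutionOfSingularities.ResolutionOfSingularities.Theorems.FrobeniusLadderFInjectiveMacaulayficationProp44SliceCurveLocal
import Literature.AlgebraicGeometry.Resolution.CurveCentreNearPointGammaPrimeRegular
import HarnessLib

/-!
# Route `RadicialJung`, crux `CleanModels` (stmt-ResolutionOfSingularities-15917), line `Sketch` rev 35, stub 6 `stub_cleanProp44` (X44c):
# FOURTEENTH CUT — at a `λ`-minimal curve situation a clean-permissible curve has NO near point over its generic point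

Seat decomp-res-hand-2 g17, sequel of the thirteenth cut ✓ `cleanProp44_of_phaseTwoMin_of_curveMin : (R1ᵐⁱⁿ) → (R3ᵐⁱⁿ) → X44c`
(`…CleanProp44CurveSliceMinCut.lean`).

The PRINTED step behind the `λ`-induction of [CoP1] Prop. 4.4 (p. 10, «working above the generic point `η(i)`»): if the curve `Y = cl{η}` of
`Σ` is blown up and a point `η′` over `η` is near, then `Γ′ = cl{η′}` is a regular curve of near points onto `Y` (Lemma 4.3 (4) =
✓ `IsBlowup.isRegular_gammaPrime_of_isNear_curve`), it contains the whole `m`-stratum upstairs (uniqueness of near points over a curve centre) and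
the colength dropped, `λ(𝒪_{X′,η′}/J′_{η′}) < λ(𝒪_{X,η}/J_η)` ([ZS] App. 5; the tree's bookkeeping ✓ `CP2008Prop44.curveData_of_isNear_generic`).  In the
clean world this step is available as soon as the curve is CLEAN-PERMISSIBLE at each of its points (✓ `IsCleanPermissibleSeq.cons`), so it can
never occur at a `λ`-MINIMAL curve situation:

* `curveMin_of_curveMinNoGamma` — **(R3ᵐⁱⁿ) ⟸ (R3ᵐⁱⁿ′)**: the residual schema of the thirteenth cut follows from the same schema with ONE MORE
  negative hypothesis «NOT (clean-permissible along the curve AND some blowing up along it has a near point over the generic point)».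
* `cleanProp44_of_phaseTwoMin_of_curveMinNoGamma` — **FOURTEENTH CUT: X44c (`stub_cleanProp44`, verbatim) ⟸ (R1ᵐⁱⁿ) ∧ (R3ᵐⁱⁿ′)**.

NET for the planner (repair census of stub 6, by name): in the curve residual (R3ᵐⁱⁿ′) a clean-permissible curve is blown up WITHOUT near curve:
its near points are finitely many closed points, among them a very near one (else ✓ `…_off_centre` settles it) — so (R3ᵐⁱⁿ′) = «an insertion is
needed somewhere on the curve» ∨ «clean-permissible, no `Γ′`, a very near ISOLATED point»: the births world of memo 4e §2.4–2.6 and nothing else.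
RE-LINE proposal: `stub_cleanProp44 := cleanProp44_of_phaseTwoMin_of_curveMinNoGamma stub_cleanPhaseTwoMin stub_cleanCurveMinNoGamma`.

Honest framing: OURS; (R1ᵐⁱⁿ) and (R3ᵐⁱⁿ′) are NOT proved here; nothing here proves X44c, any case of `CleanModels`, or resolution of singularities in
characteristic `p`. [cite: CossartPiltant2008, Prop. 4.4 (proof, p. 10), Lemma 4.3 (4)] [cite: ZariskiSamuel1960, Appendix 5, Thm. 3]
[cite: Piltant2013, §2 Axiom 4]
-/

noncomputable section

set_option linter.dupNamespace false -- mandated namespace of this single-conjunct summit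

open CategoryTheory CategoryTheory.Limits AlgebraicGeometry TopologicalSpace IsLocalRing
open Literature.AlgebraicGeometry.Resolution Literature.AlgebraicGeometry.Motives
open Scheme.IdealSheafData
open Summit.ResolutionOfSingularities.ResolutionOfSingularities.Theorems.CP2008Prop44

namespace Summit.ResolutionOfSingularities.ResolutionOfSingularities.Theorems.RadicialJung.CleanModels

/-! ## §1 (R3ᵐⁱⁿ) ⟸ (R3ᵐⁱⁿ′): no near curve over a clean-permissible `λ`-minimal curve -/

set_option maxHeartbeats 1600000 in
-- long binder lists; one curve blowing-up with its bookkeeping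
/-- **(R3ᵐⁱⁿ) ⟸ (R3ᵐⁱⁿ′).**  At a `λ`-minimal curve situation `(X, J, G, η)` (hypothesis `(min)`), it is impossible that the curve `cl{η}` be
clean-permissible at each of its points AND that some blowing up along it carry a near point `η′` over `η`: the blowing up would be a
clean-permissible step to the curve situation `(X′, J′, G′, η′)` of strictly smaller `λ`.  See the module docstring.
[cite: CossartPiltant2008, Prop. 4.4 (proof, p. 10), Lemma 4.3 (4)] [cite: ZariskiSamuel1960, Appendix 5, Thm. 3] [cite: Piltant2013, §2 Axiom 4] -/
theorem curveMin_of_curveMinNoGamma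
    (hcurveMinNoGamma : ∀ (p : ℕ), p.Prime → ∀ {X : Scheme.{0}} [IsIntegral X] [IsNoetherian X], CharP X.functionField p →
      ∀ (hX : Scheme.IsRegular X), Scheme.IsQuasiExcellent X → topologicalKrullDim X ≤ 3 →
      ∀ (G : X.functionField), (∀ x : X, CleanRegAt p (algebraMap (X.presheaf.stalk x) X.functionField) G) →
      ∀ (J : X.IdealSheafData) {m : ℕ}, 1 ≤ m → (∀ z, idealOrder J z ≤ m) → (∀ z ∈ J.support, 1 < Order.coheight z) →
      ∀ (η : X), ¬ IsClosed ({η} : Set X) →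
        Scheme.IsRegular (vanishingIdeal (⟨closure {η}, isClosed_closure⟩ : Closeds X)).subscheme →
        (∀ z : X, (m : ℕ∞) ≤ idealOrder J z → z ∈ closure ({η} : Set X)) →
        (∀ y ∈ closure ({η} : Set X), idealOrder J y = m) →
      -- (τ1) some closed threefold point of order `m` has `τ = 1`
      ¬ (∀ x : X, IsClosed ({x} : Set X) → idealOrder J x = m → (maximalIdeal (X.presheaf.stalk x)).spanFinrank = 3 →
          ∀ hr : IsRegularLocalRing (X.presheaf.stalk x), 2 ≤ @stalkTau X J x hr m) →
      -- (vn′) NOT (clean-permissible along the curve AND no very near point over it)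
      ¬ ((∀ y ∈ closure ({η} : Set X), CleanPermissibleAt p (algebraMap (X.presheaf.stalk y) X.functionField) G
            (stalkIdeal (vanishingIdeal (⟨closure {η}, isClosed_closure⟩ : Closeds X)) y)) ∧
          (∀ (X₉ : Scheme.{0}) (π : X₉ ⟶ X), IsBlowup π (vanishingIdeal (⟨closure {η}, isClosed_closure⟩ : Closeds X)) →
            ∀ x' : X₉, IsClosed ({x'} : Set X₉) → π x' ∈ closure ({η} : Set X) →
              idealOrder (controlledTransform π (vanishingIdeal (⟨closure {η}, isClosed_closure⟩ : Closeds X)) J m) x' = m →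
              (maximalIdeal (X₉.presheaf.stalk x')).spanFinrank = 3 →
              ∀ hr : IsRegularLocalRing (X₉.presheaf.stalk x'),
                2 ≤ @stalkTau X₉ (controlledTransform π (vanishingIdeal (⟨closure {η}, isClosed_closure⟩ : Closeds X)) J m) x' hr m)) →
      -- (noΓ′) NOT (clean-permissible along the curve AND a near point over its generic point after blowing it up)
      ¬ ((∀ y ∈ closure ({η} : Set X), CleanPermissibleAt p (algebraMap (X.presheaf.stalk y) X.functionField) G
            (stalkIdeal (vanishingIdeal (⟨closure {η}, isClosed_closure⟩ : Closeds X)) y)) ∧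
          ∃ (X₉ : Scheme.{0}) (π : X₉ ⟶ X) (_ : IsBlowup π (vanishingIdeal (⟨closure {η}, isClosed_closure⟩ : Closeds X))) (η' : X₉),
            π η' = η ∧ idealOrder (controlledTransform π (vanishingIdeal (⟨closure {η}, isClosed_closure⟩ : Closeds X)) J m) η' = m) →
      -- (min) `λ` does not drop along any clean-permissible sequence reaching a curve situation
      (∀ (X₁ : Scheme.{0}) [IsIntegral X₁] (Φ : X₁ ⟶ X) [IsDominant Φ] (J₁ : X₁.IdealSheafData),
        IsCleanPermissibleSeq p Φ J m J₁ G → ∀ η₁ : X₁,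
        ¬ IsClosed ({η₁} : Set X₁) →
        Scheme.IsRegular (vanishingIdeal (⟨closure {η₁}, isClosed_closure⟩ : Closeds X₁)).subscheme →
        (∀ z : X₁, (m : ℕ∞) ≤ idealOrder J₁ z → z ∈ closure ({η₁} : Set X₁)) →
        (∀ y ∈ closure ({η₁} : Set X₁), idealOrder J₁ y = m) →
        (Module.length (X.presheaf.stalk η) (X.presheaf.stalk η ⧸ stalkIdeal J η)).toNat ≤
          (Module.length (X₁.presheaf.stalk η₁) (X₁.presheaf.stalk η₁ ⧸ stalkIdeal J₁ η₁)).toNat) →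
      ∃ (X' : Scheme.{0}) (π : X' ⟶ X) (_ : IsIntegral X') (_ : IsDominant π) (J' : X'.IdealSheafData),
        IsCleanPermissibleSeq p π J m J' G ∧ ∀ x, idealOrder J' x < m) :
    ∀ (p : ℕ), p.Prime → ∀ {X : Scheme.{0}} [IsIntegral X] [IsNoetherian X], CharP X.functionField p →
      ∀ (hX : Scheme.IsRegular X), Scheme.IsQuasiExcellent X → topologicalKrullDim X ≤ 3 →
      ∀ (G : X.functionField), (∀ x : X, CleanRegAt p (algebraMap (X.presheaf.stalk x) X.functionField) G) →
      ∀ (J : X.IdealSheafData) {m : ℕ}, 1 ≤ m → (∀ z, idealOrder J z ≤ m) → (∀ z ∈ J.support, 1 < Order.coheight z) →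
      ∀ (η : X), ¬ IsClosed ({η} : Set X) →
        Scheme.IsRegular (vanishingIdeal (⟨closure {η}, isClosed_closure⟩ : Closeds X)).subscheme →
        (∀ z : X, (m : ℕ∞) ≤ idealOrder J z → z ∈ closure ({η} : Set X)) →
        (∀ y ∈ closure ({η} : Set X), idealOrder J y = m) →
      -- (τ1) some closed threefold point of order `m` has `τ = 1`
      ¬ (∀ x : X, IsClosed ({x} : Set X) → idealOrder J x = m → (maximalIdeal (X.presheaf.stalk x)).spanFinrank = 3 →
          ∀ hr : IsRegularLocalRing (X.presheaf.stalk x), 2 ≤ @stalkTau X J x hr m) →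
      -- (vn′) NOT (clean-permissible along the curve AND no very near point over it)
      ¬ ((∀ y ∈ closure ({η} : Set X), CleanPermissibleAt p (algebraMap (X.presheaf.stalk y) X.functionField) G
            (stalkIdeal (vanishingIdeal (⟨closure {η}, isClosed_closure⟩ : Closeds X)) y)) ∧
          (∀ (X₉ : Scheme.{0}) (π : X₉ ⟶ X), IsBlowup π (vanishingIdeal (⟨closure {η}, isClosed_closure⟩ : Closeds X)) →
            ∀ x' : X₉, IsClosed ({x'} : Set X₉) → π x' ∈ closure ({η} : Set X) →
              idealOrder (controlledTransform π (vanishingIdeal (⟨closure {η}, isClosed_closure⟩ : Closeds X)) J m) x' = m →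
              (maximalIdeal (X₉.presheaf.stalk x')).spanFinrank = 3 →
              ∀ hr : IsRegularLocalRing (X₉.presheaf.stalk x'),
                2 ≤ @stalkTau X₉ (controlledTransform π (vanishingIdeal (⟨closure {η}, isClosed_closure⟩ : Closeds X)) J m) x' hr m)) →
      -- (min) `λ` does not drop along any clean-permissible sequence reaching a curve situation
      (∀ (X₁ : Scheme.{0}) [IsIntegral X₁] (Φ : X₁ ⟶ X) [IsDominant Φ] (J₁ : X₁.IdealSheafData),
        IsCleanPermissibleSeq p Φ J m J₁ G → ∀ η₁ : X₁,
        ¬ IsClosed ({η₁} : Set X₁) →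
        Scheme.IsRegular (vanishingIdeal (⟨closure {η₁}, isClosed_closure⟩ : Closeds X₁)).subscheme →
        (∀ z : X₁, (m : ℕ∞) ≤ idealOrder J₁ z → z ∈ closure ({η₁} : Set X₁)) →
        (∀ y ∈ closure ({η₁} : Set X₁), idealOrder J₁ y = m) →
        (Module.length (X.presheaf.stalk η) (X.presheaf.stalk η ⧸ stalkIdeal J η)).toNat ≤
          (Module.length (X₁.presheaf.stalk η₁) (X₁.presheaf.stalk η₁ ⧸ stalkIdeal J₁ η₁)).toNat) →
      ∃ (X' : Scheme.{0}) (π : X' ⟶ X) (_ : IsIntegral X') (_ : IsDominant π) (J' : X'.IdealSheafData),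
        IsCleanPermissibleSeq p π J m J' G ∧ ∀ x, idealOrder J' x < m := by
  intro p hp X _ _ hchar hX hqe hX3 G hG J m hm hle hcodim η hηcl hYreg hstr hord hτ hvn hmin
  refine hcurveMinNoGamma p hp hchar hX hqe hX3 G hG J hm hle hcodim η hηcl hYreg hstr hord hτ hvn ?_ hmin
  rintro ⟨hcp, X₁, π, hπ, η', hη'η, hnear'⟩
  classical
  haveI := hchar
  have hcoh3 : ∀ z : X, Order.coheight z ≤ 3 := (topologicalKrullDim_le_iff_forall_coheight_le X 3).mp hX3
  have hηY : η ∈ closure ({η} : Set X) := subset_closure rfl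
  have hsuppη : η ∈ J.support := by
    rw [← one_le_idealOrder_iff, hord η hηY]
    exact_mod_cast hm
  have hcoh : Order.coheight η = 2 := coheight_eq_two_of_not_isClosed hcoh3 (hcodim η hsuppη) hηcl
  have hYirr : IsIrreducible (((⟨closure {η}, isClosed_closure⟩ : Closeds X)) : Set X) := isIrreducible_singleton.closure
  -- the blowing up along the curve: an integral dominant proper top, and a CLEAN-permissible step
  have hJne : J ≠ ⊥ := ne_bot_of_forall_one_lt_coheight hcodim
  have hYne : vanishingIdeal (⟨closure {η}, isClosed_closure⟩ : Closeds X) ≠ ⊥ :=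
    vanishingIdeal_ne_bot_of_forall_idealOrder_eq hJne hm hord
  haveI : IsIntegral X₁ := hπ.isIntegral hYne
  haveI : IsDominant π := isDominant_of_isBlowup_of_ne_bot hπ hYne
  haveI : IsProper π := hπ.isProper
  haveI : IsLocallyNoetherian X₁ := hπ.isLocallyNoetherian
  have hseq₁' : IsCleanPermissibleSeq p (π ≫ 𝟙 X) J m
      (controlledTransform π (vanishingIdeal (⟨closure {η}, isClosed_closure⟩ : Closeds X)) J m) G :=
    IsCleanPermissibleSeq.cons π (𝟙 X) J m J G ⟨closure {η}, isClosed_closure⟩ (IsCleanPermissibleSeq.nil J m G)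
      (isIntegral_subscheme_closure η) hYreg hord hπ (fun y hy => by rw [RatFn.functionFieldMap_id]; exact hcp y hy)
  have hseq₁ : IsCleanPermissibleSeq p π J m
      (controlledTransform π (vanishingIdeal (⟨closure {η}, isClosed_closure⟩ : Closeds X)) J m) G := by
    simpa only [Category.comp_id] using hseq₁'
  -- the near curve `Γ′ = cl{η′}` (Lemma 4.3 (4)) and the next curve instance (tree bookkeeping, over the open `⊤`)
  have hnear : IsNear π (vanishingIdeal (⟨closure {η}, isClosed_closure⟩ : Closeds X)) J m η' := isNear_iff.mpr hnear'
  have hη'Y : closure {π η'} = (((⟨closure {η}, isClosed_closure⟩ : Closeds X)) : Set X) := by rw [hη'η]; rfl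
  have hcodπ : Order.coheight (π η') = 2 := by rw [hη'η]; exact hcoh
  obtain ⟨hΓreg, hnearΓ, hontoΓ⟩ := hπ.isRegular_gammaPrime_of_isNear_curve hX hYirr hYreg hm hord hle hη'Y hcodπ hnear
  have hdata := curveData_of_isNear_generic hm hX hqe hX3 J hle hcodim ⊤ ⟨closure {η}, isClosed_closure⟩ η rfl hcoh hYreg
    (fun x _ => TopologicalSpace.Opens.mem_top x) (fun z hz => Or.inl (hstr z hz)) hord π hπ hη'η hnear hnearΓ hontoΓ
  obtain ⟨-, -, -, -, -, -, -, -, -, hbadΓ, hordΓ, hlt, hfin⟩ := hdata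
  -- `η′` is not closed (it maps to `η`), and `Γ′` contains the whole `m`-stratum upstairs
  have hη'cl : ¬ IsClosed ({η'} : Set X₁) := by
    intro h
    have h2 := π.isClosedMap _ h
    rw [Set.image_singleton, hη'η] at h2
    exact hηcl h2
  have hstr' : ∀ z : X₁, (m : ℕ∞) ≤ idealOrder
      (controlledTransform π (vanishingIdeal (⟨closure {η}, isClosed_closure⟩ : Closeds X)) J m) z → z ∈ closure ({η'} : Set X₁) :=
    fun z hz => (hbadΓ z hz).resolve_right fun h => h (by simp)
  -- `λ`-minimality against the colength drop
  have hge := hmin X₁ π _ hseq₁ η' hη'cl hΓreg hstr' hordΓ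
  obtain ⟨k, hk⟩ := ENat.ne_top_iff_exists.mp hfin.ne
  obtain ⟨k', hk'⟩ := ENat.ne_top_iff_exists.mp (ne_top_of_lt hlt)
  rw [← hk, ← hk'] at hge hlt
  simp only [ENat.toNat_coe] at hge
  have hlt' : k' < k := by exact_mod_cast hlt
  omega

/-! ## §2 FOURTEENTH CUT: X44c ⟸ (R1ᵐⁱⁿ) ∧ (R3ᵐⁱⁿ′) -/

set_option maxHeartbeats 1600000 in
-- long binder lists
/-- **THE CLEAN ASSEMBLY, FOURTEENTH CUT: X44c (`stub_cleanProp44`, verbatim) ⟸ (R1ᵐⁱⁿ) ∧ (R3ᵐⁱⁿ′)** — ✓ `cleanProp44_of_phaseTwoMin_of_curveMin` with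
its curve residual narrowed by `curveMin_of_curveMinNoGamma`: at the `λ`-minimal curve situations a clean-permissible curve carries no near curve.
[cite: CossartPiltant2008, Prop. 4.2 (b), Prop. 4.4 (proof, pp. 10–11), Lemma 4.3 (4), Lemma 4.5] [cite: CossartJannsenSaito2020, Thm. 13.7]
[cite: Piltant2013, §2 Axiom 4, Prop. 5.1 (proof, Step 2)] -/
theorem cleanProp44_of_phaseTwoMin_of_curveMinNoGamma
    (hphaseTwoMin : ∀ (p : ℕ), p.Prime → ∀ {X : Scheme.{0}} [IsIntegral X] [IsNoetherian X], CharP X.functionField p →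
      ∀ (hX : Scheme.IsRegular X), Scheme.IsQuasiExcellent X → topologicalKrullDim X ≤ 3 →
      ∀ (G : X.functionField), (∀ x : X, CleanRegAt p (algebraMap (X.presheaf.stalk x) X.functionField) G) →
      ∀ (J : X.IdealSheafData) {μ : ℕ}, 1 ≤ μ → (∀ z, idealOrder J z ≤ μ) → (∀ z ∈ J.support, 1 < Order.coheight z) →
      (∀ x : X, ¬ ∃ C ∈ {C : Closeds X | ∃ ζ ∈ maxPoints {z : X | (μ : ℕ∞) ≤ idealOrder J z},
          ¬ IsClosed ({ζ} : Set X) ∧ C = ⟨closure {ζ}, isClosed_closure⟩},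
        x ∈ (vanishingIdeal C).subschemeι '' (Scheme.regularLocus (vanishingIdeal C).subscheme)ᶜ ∨
        (x ∈ (C : Set X) ∧ ∃ C' ∈ {C : Closeds X | ∃ ζ ∈ maxPoints {z : X | (μ : ℕ∞) ≤ idealOrder J z},
            ¬ IsClosed ({ζ} : Set X) ∧ C = ⟨closure {ζ}, isClosed_closure⟩}, C' ≠ C ∧ x ∈ (C' : Set X) ∧
          stalkIdeal (vanishingIdeal C) x ⊔ stalkIdeal (vanishingIdeal C') x ≠ maximalIdeal (X.presheaf.stalk x))) →
      -- (meet) two distinct curves of `Σ` meet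
      (∃ ζ₁ ζ₂ : X, (μ : ℕ∞) ≤ idealOrder J ζ₁ ∧ Order.coheight ζ₁ = 2 ∧ ¬ IsClosed ({ζ₁} : Set X) ∧
          (μ : ℕ∞) ≤ idealOrder J ζ₂ ∧ Order.coheight ζ₂ = 2 ∧ ¬ IsClosed ({ζ₂} : Set X) ∧ ζ₁ ≠ ζ₂ ∧
          ¬ Disjoint (closure ({ζ₁} : Set X)) (closure {ζ₂})) →
      -- (min) `Λ` does not drop along any clean-permissible sequence reaching a stage without bad points
      (∀ (X₁ : Scheme.{0}) [IsIntegral X₁] (Φ : X₁ ⟶ X) [IsDominant Φ] (J₁ : X₁.IdealSheafData),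
        IsCleanPermissibleSeq p Φ J μ J₁ G →
        (∀ x : X₁, ¬ ∃ C ∈ {C : Closeds X₁ | ∃ ζ ∈ maxPoints {z : X₁ | (μ : ℕ∞) ≤ idealOrder J₁ z},
            ¬ IsClosed ({ζ} : Set X₁) ∧ C = ⟨closure {ζ}, isClosed_closure⟩},
          x ∈ (vanishingIdeal C).subschemeι '' (Scheme.regularLocus (vanishingIdeal C).subscheme)ᶜ ∨
          (x ∈ (C : Set X₁) ∧ ∃ C' ∈ {C : Closeds X₁ | ∃ ζ ∈ maxPoints {z : X₁ | (μ : ℕ∞) ≤ idealOrder J₁ z},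
              ¬ IsClosed ({ζ} : Set X₁) ∧ C = ⟨closure {ζ}, isClosed_closure⟩}, C' ≠ C ∧ x ∈ (C' : Set X₁) ∧
            stalkIdeal (vanishingIdeal C) x ⊔ stalkIdeal (vanishingIdeal C') x ≠ maximalIdeal (X₁.presheaf.stalk x))) →
        (∑ᶠ ζ ∈ {ζ : X | ζ ∈ maxPoints {z : X | (μ : ℕ∞) ≤ idealOrder J z} ∧ ¬ IsClosed ({ζ} : Set X)},
            (Module.length (X.presheaf.stalk ζ) (X.presheaf.stalk ζ ⧸ stalkIdeal J ζ)).toNat) ≤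
          (∑ᶠ ζ ∈ {ζ : X₁ | ζ ∈ maxPoints {z : X₁ | (μ : ℕ∞) ≤ idealOrder J₁ z} ∧ ¬ IsClosed ({ζ} : Set X₁)},
              (Module.length (X₁.presheaf.stalk ζ) (X₁.presheaf.stalk ζ ⧸ stalkIdeal J₁ ζ)).toNat)) →
      ∃ (X₁ : Scheme.{0}) (Φ : X₁ ⟶ X) (_ : IsIntegral X₁) (_ : IsDominant Φ) (J₁ : X₁.IdealSheafData)
        (_ : IsCleanPermissibleSeq p Φ J μ J₁ G),
        (∀ ζ : X₁, (μ : ℕ∞) ≤ idealOrder J₁ ζ → Order.coheight ζ = 2 → ¬ IsClosed ({ζ} : Set X₁) →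
            Scheme.IsRegular (vanishingIdeal (⟨closure {ζ}, isClosed_closure⟩ : Closeds X₁)).subscheme) ∧
        (∀ ζ₁ ζ₂ : X₁, (μ : ℕ∞) ≤ idealOrder J₁ ζ₁ → Order.coheight ζ₁ = 2 → ¬ IsClosed ({ζ₁} : Set X₁) →
            (μ : ℕ∞) ≤ idealOrder J₁ ζ₂ → Order.coheight ζ₂ = 2 → ¬ IsClosed ({ζ₂} : Set X₁) → ζ₁ ≠ ζ₂ →
            Disjoint (closure ({ζ₁} : Set X₁)) (closure {ζ₂})))
    (hcurveMinNoGamma : ∀ (p : ℕ), p.Prime → ∀ {X : Scheme.{0}} [IsIntegral X] [IsNoetherian X], CharP X.functionField p →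
      ∀ (hX : Scheme.IsRegular X), Scheme.IsQuasiExcellent X → topologicalKrullDim X ≤ 3 →
      ∀ (G : X.functionField), (∀ x : X, CleanRegAt p (algebraMap (X.presheaf.stalk x) X.functionField) G) →
      ∀ (J : X.IdealSheafData) {m : ℕ}, 1 ≤ m → (∀ z, idealOrder J z ≤ m) → (∀ z ∈ J.support, 1 < Order.coheight z) →
      ∀ (η : X), ¬ IsClosed ({η} : Set X) →
        Scheme.IsRegular (vanishingIdeal (⟨closure {η}, isClosed_closure⟩ : Closeds X)).subscheme →
        (∀ z : X, (m : ℕ∞) ≤ idealOrder J z → z ∈ closure ({η} : Set X)) →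
        (∀ y ∈ closure ({η} : Set X), idealOrder J y = m) →
      -- (τ1) some closed threefold point of order `m` has `τ = 1`
      ¬ (∀ x : X, IsClosed ({x} : Set X) → idealOrder J x = m → (maximalIdeal (X.presheaf.stalk x)).spanFinrank = 3 →
          ∀ hr : IsRegularLocalRing (X.presheaf.stalk x), 2 ≤ @stalkTau X J x hr m) →
      -- (vn′) NOT (clean-permissible along the curve AND no very near point over it)
      ¬ ((∀ y ∈ closure ({η} : Set X), CleanPermissibleAt p (algebraMap (X.presheaf.stalk y) X.functionField) G
            (stalkIdeal (vanishingIdeal (⟨closure {η}, isClosed_closure⟩ : Closeds X)) y)) ∧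
          (∀ (X₉ : Scheme.{0}) (π : X₉ ⟶ X), IsBlowup π (vanishingIdeal (⟨closure {η}, isClosed_closure⟩ : Closeds X)) →
            ∀ x' : X₉, IsClosed ({x'} : Set X₉) → π x' ∈ closure ({η} : Set X) →
              idealOrder (controlledTransform π (vanishingIdeal (⟨closure {η}, isClosed_closure⟩ : Closeds X)) J m) x' = m →
              (maximalIdeal (X₉.presheaf.stalk x')).spanFinrank = 3 →
              ∀ hr : IsRegularLocalRing (X₉.presheaf.stalk x'),
                2 ≤ @stalkTau X₉ (controlledTransform π (vanishingIdeal (⟨closure {η}, isClosed_closure⟩ : Closeds X)) J m) x' hr m)) →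
      -- (noΓ′) NOT (clean-permissible along the curve AND a near point over its generic point after blowing it up)
      ¬ ((∀ y ∈ closure ({η} : Set X), CleanPermissibleAt p (algebraMap (X.presheaf.stalk y) X.functionField) G
            (stalkIdeal (vanishingIdeal (⟨closure {η}, isClosed_closure⟩ : Closeds X)) y)) ∧
          ∃ (X₉ : Scheme.{0}) (π : X₉ ⟶ X) (_ : IsBlowup π (vanishingIdeal (⟨closure {η}, isClosed_closure⟩ : Closeds X))) (η' : X₉),
            π η' = η ∧ idealOrder (controlledTransform π (vanishingIdeal (⟨closure {η}, isClosed_closure⟩ : Closeds X)) J m) η' = m) →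
      -- (min) `λ` does not drop along any clean-permissible sequence reaching a curve situation
      (∀ (X₁ : Scheme.{0}) [IsIntegral X₁] (Φ : X₁ ⟶ X) [IsDominant Φ] (J₁ : X₁.IdealSheafData),
        IsCleanPermissibleSeq p Φ J m J₁ G → ∀ η₁ : X₁,
        ¬ IsClosed ({η₁} : Set X₁) →
        Scheme.IsRegular (vanishingIdeal (⟨closure {η₁}, isClosed_closure⟩ : Closeds X₁)).subscheme →
        (∀ z : X₁, (m : ℕ∞) ≤ idealOrder J₁ z → z ∈ closure ({η₁} : Set X₁)) →
        (∀ y ∈ closure ({η₁} : Set X₁), idealOrder J₁ y = m) →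
        (Module.length (X.presheaf.stalk η) (X.presheaf.stalk η ⧸ stalkIdeal J η)).toNat ≤
          (Module.length (X₁.presheaf.stalk η₁) (X₁.presheaf.stalk η₁ ⧸ stalkIdeal J₁ η₁)).toNat) →
      ∃ (X' : Scheme.{0}) (π : X' ⟶ X) (_ : IsIntegral X') (_ : IsDominant π) (J' : X'.IdealSheafData),
        IsCleanPermissibleSeq p π J m J' G ∧ ∀ x, idealOrder J' x < m) :
    ∀ (p : ℕ), p.Prime → ∀ (S : Scheme.{0}) [IsIntegral S] [IsNoetherian S],
      CharP S.functionField p → Scheme.IsRegular S → Scheme.IsExcellent S → topologicalKrullDim S = 3 →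
      ∀ G₀ : S.functionField, (∀ s : S, CleanRegAt p (algebraMap (S.presheaf.stalk s) S.functionField) G₀) →
      ∀ I : S.IdealSheafData, I ≠ ⊥ →
      ∀ (X : Scheme.{0}) (ρ : X ⟶ S) [IsIntegral X] [IsNoetherian X] [IsDominant ρ],
        IsCleanRegularCentreBlowupSeq p ρ I G₀ →
        (∀ x : X, CleanRegAt p (algebraMap (X.presheaf.stalk x) X.functionField) (RatFn.functionFieldMap ρ G₀)) →
        ∀ (J : X.IdealSheafData) (μ : ℕ), 1 ≤ μ →
          (∀ x ∈ J.support, 1 < Order.coheight x) → (∀ x, idealOrder J x ≤ μ) → (∃ x, idealOrder J x = μ) →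
          ∃ (X' : Scheme.{0}) (π : X' ⟶ X) (_ : IsIntegral X') (_ : IsDominant π) (J' : X'.IdealSheafData),
            IsCleanPermissibleSeq p π J μ J' (RatFn.functionFieldMap ρ G₀) ∧ ∀ x, idealOrder J' x < μ :=
  cleanProp44_of_phaseTwoMin_of_curveMin hphaseTwoMin (curveMin_of_curveMinNoGamma hcurveMinNoGamma)

end Summit.ResolutionOfSingularities.ResolutionOfSingularities.Theorems.RadicialJung.CleanModels

end
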